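import Summits.QuantumFields.GaugeBoot.DiagonalRPTorusOddGaugeInvariantNegative
import Summits.QuantumFields.GaugeBoot.DiagonalRPTorusEvenGaugeInvariantAllBeta
import Summits.QuantumFields.GaugeBoot.DiagonalRPTorusTwoAllBeta
import HarnessLib

/-!
# The two-dimensional torus table of closed-half diagonal reflection positivity, full and
gauge-invariant, for `SU(2n)` and `U(N)` (gauge-boot, L3 torus classification; summary module)

HONEST FRAMING (cell `pub-gaugeboot`, page 1 of every file): the venture produces certified bounds
on lattice expectations at stated coupling, gauge group, dimension and torus size; NOT a mass gap,
NOT a continuum limit, NOT a string tension; NOT Yang–Mills-summit-bearing (barriers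
`FixedCouplingUltralocality`, `PerturbativeInvisibility`). A summary of structural torus results;
no two-dimensional certificate with a diagonal block exists or is planned.

## Content

On the square torus `(ℤ/L)²`, `L ≥ 4`, for `SU(M)` with `M` even (the cell's `SU(2)`) and for
`U(N)`, `N ≥ 1`, in the fundamental representation, and every real `β`:

* ★★★ **`gaugeInvariantDiagonalRP_two_iff_su2n` / `_uN`** — the GAUGE-INVARIANT closed-half
  diagonal RP holds `↔ (Even L ∨ 0 ≤ β)` (even `L`: every `β`,
  `gaugeInvariantDiagonalRP_two_even_allBeta_*`; odd `L`: `↔ 0 ≤ β`,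
  `gaugeInvariantDiagonalRP_odd_iff_*`);
* ★★★ **`diagonalRP_two_table_su2n` / `_uN`** — side by side with the FULL closed-half statement
  of the tree (`diagonalReflectionPositive_two_iff_*`: `↔ (Odd L ∧ 0 ≤ β) ∨ β = 0`): on even tori the
  full statement fails at every `β ≠ 0` while the gauge-invariant one always holds (a pure gauge
  artefact); on odd tori both hold exactly for `β ≥ 0` (at `β < 0` a Wilson loop — the staircase
  along the mirror — violates positivity).

`L = 2, 3` and `SU(2n+1)` on even tori at `β < 0` are not covered (see the two source modules).
-/

noncomputable section

open MeasureTheory Complex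
open scoped ComplexOrder

namespace Summit.QuantumFields.GaugeBoot

open Literature.MathematicalPhysics.QuantumFieldTheory
open Literature.MathematicalPhysics.QuantumLattice (fundamentalRep unitaryFundamentalRep)

namespace DiagRPTwo

/-- ★★★ **`SU(M)`, `M` even, `M ≥ 2`, on `(ℤ/L)²` with `L ≥ 4`**: the gauge-invariant closed-half
diagonal RP holds iff `L` is even or `0 ≤ β`. -/
theorem gaugeInvariantDiagonalRP_two_iff_su2n {L M : ℕ} [NeZero L] (h4 : 4 ≤ L) (hM : Even M)
    (hM2 : 2 ≤ M) {i j : Fin 2} (hij : i ≠ j) (β : ℝ) :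
    GaugeInvariantDiagonalRP (d := 2) (L := L) (fundamentalRep (Fin M)) β i j ↔ (Even L ∨ 0 ≤ β) := by
  rcases Nat.even_or_odd L with hE | hO
  · exact ⟨fun _ => Or.inl hE,
      fun _ => gaugeInvariantDiagonalRP_two_even_allBeta_su2n hE h4 hM hij β⟩
  · have h5 : 5 ≤ L := by obtain ⟨r, hr⟩ := hO; omega
    rw [gaugeInvariantDiagonalRP_odd_iff_suN hO h5 hM2 hij β]
    exact ⟨Or.inr, fun h => h.resolve_left fun hE => (Nat.not_even_iff_odd.2 hO) hE⟩

/-- ★★★ **`U(N)`, `N ≥ 1`, on `(ℤ/L)²` with `L ≥ 4`**: the gauge-invariant closed-half diagonal RP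
holds iff `L` is even or `0 ≤ β`. -/
theorem gaugeInvariantDiagonalRP_two_iff_uN {L N : ℕ} [NeZero L] (h4 : 4 ≤ L) (hN : 1 ≤ N)
    {i j : Fin 2} (hij : i ≠ j) (β : ℝ) :
    GaugeInvariantDiagonalRP (d := 2) (L := L) (unitaryFundamentalRep (Fin N) ℂ) β i j ↔
      (Even L ∨ 0 ≤ β) := by
  rcases Nat.even_or_odd L with hE | hO
  · exact ⟨fun _ => Or.inl hE, fun _ => gaugeInvariantDiagonalRP_two_even_allBeta_uN hE h4 hij β⟩
  · have h5 : 5 ≤ L := by obtain ⟨r, hr⟩ := hO; omega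
    rw [gaugeInvariantDiagonalRP_odd_iff_uN hO h5 hN hij β]
    exact ⟨Or.inr, fun h => h.resolve_left fun hE => (Nat.not_even_iff_odd.2 hO) hE⟩

/-- ★★★ **The `SU(2n)` torus table** (`(ℤ/L)²`, `L ≥ 4`, `M` even, `M ≥ 2`, every real `β`): the
FULL closed-half diagonal RP holds iff `(Odd L ∧ 0 ≤ β) ∨ β = 0`, the GAUGE-INVARIANT one iff
`Even L ∨ 0 ≤ β`. -/
theorem diagonalRP_two_table_su2n {L M : ℕ} [NeZero L] (h4 : 4 ≤ L) (hM : Even M) (hM2 : 2 ≤ M)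
    {i j : Fin 2} (hij : i ≠ j) (β : ℝ) :
    (DiagonalReflectionPositive (d := 2) (L := L) (fundamentalRep (Fin M)) β i j ↔
        (Odd L ∧ 0 ≤ β) ∨ β = 0) ∧
      (GaugeInvariantDiagonalRP (d := 2) (L := L) (fundamentalRep (Fin M)) β i j ↔
        (Even L ∨ 0 ≤ β)) :=
  ⟨diagonalReflectionPositive_two_iff_suN hM2 (by omega) β hij,
    gaugeInvariantDiagonalRP_two_iff_su2n h4 hM hM2 hij β⟩

/-- ★★★ **The `U(N)` torus table** (`(ℤ/L)²`, `L ≥ 4`, `N ≥ 1`, every real `β`). -/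
theorem diagonalRP_two_table_uN {L N : ℕ} [NeZero L] (h4 : 4 ≤ L) (hN : 1 ≤ N) {i j : Fin 2}
    (hij : i ≠ j) (β : ℝ) :
    (DiagonalReflectionPositive (d := 2) (L := L) (unitaryFundamentalRep (Fin N) ℂ) β i j ↔
        (Odd L ∧ 0 ≤ β) ∨ β = 0) ∧
      (GaugeInvariantDiagonalRP (d := 2) (L := L) (unitaryFundamentalRep (Fin N) ℂ) β i j ↔
        (Even L ∨ 0 ≤ β)) :=
  ⟨diagonalReflectionPositive_two_iff_uN hN (by omega) β hij,
    gaugeInvariantDiagonalRP_two_iff_uN h4 hN hij β⟩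

/-- ★★ **On even two-tori the diagonal obstruction is a pure gauge artefact** (`SU(M)`, `M` even,
`M ≥ 2`; `L ≥ 4` even; `β ≠ 0`): the full closed-half RP fails while the gauge-invariant one holds. -/
theorem even_torus_gauge_artefact_su2n {L M : ℕ} [NeZero L] (hL : Even L) (h4 : 4 ≤ L) (hM : Even M)
    (hM2 : 2 ≤ M) {i j : Fin 2} (hij : i ≠ j) {β : ℝ} (hβ : β ≠ 0) :
    ¬ DiagonalReflectionPositive (d := 2) (L := L) (fundamentalRep (Fin M)) β i j ∧
      GaugeInvariantDiagonalRP (d := 2) (L := L) (fundamentalRep (Fin M)) β i j := by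
  refine ⟨fun h => ?_, gaugeInvariantDiagonalRP_two_even_allBeta_su2n hL h4 hM hij β⟩
  rcases (diagonalReflectionPositive_two_iff_suN hM2 (by omega) β hij).1 h with ⟨hO, -⟩ | h0
  · exact (Nat.not_even_iff_odd.2 hO) hL
  · exact hβ h0

/-- ★★ **On odd two-tori at `β < 0` the failure is gauge invariant** (`SU(M)`, `M` even, `M ≥ 2`;
`L ≥ 5` odd): neither the full nor the gauge-invariant closed-half diagonal RP holds. -/
theorem odd_torus_neg_failure_su2n {L M : ℕ} [NeZero L] (hL : Odd L) (h5 : 5 ≤ L) (hM : Even M)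
    (hM2 : 2 ≤ M) {i j : Fin 2} (hij : i ≠ j) {β : ℝ} (hβ : β < 0) :
    ¬ DiagonalReflectionPositive (d := 2) (L := L) (fundamentalRep (Fin M)) β i j ∧
      ¬ GaugeInvariantDiagonalRP (d := 2) (L := L) (fundamentalRep (Fin M)) β i j := by
  have hG : ¬ GaugeInvariantDiagonalRP (d := 2) (L := L) (fundamentalRep (Fin M)) β i j := fun h =>
    absurd ((gaugeInvariantDiagonalRP_two_iff_su2n (by omega) hM hM2 hij β).1 h)
      (by
        rintro (hE | hβ')
        · exact (Nat.not_even_iff_odd.2 hL) hE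
        · exact absurd hβ' (not_le.2 hβ))
  exact ⟨fun h => hG h.gaugeInvariantDiagonalRP, hG⟩

end DiagRPTwo

end Summit.QuantumFields.GaugeBoot
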